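import Summits.QuantumFields.YangMills.Theorems.FluctuationComparisonRegPrIntLS2BetaCovariantOscillationOfThm2
import Summits.QuantumFields.YangMills.Theorems.FluctuationComparisonRegPrIntLS2BetaCoarseCurlRemainderCovariant
import Summits.QuantumFields.YangMills.Theorems.FluctuationComparisonRegPrIntLS2BetaCovariantOscillationTorusComb
import HarnessLib

/-!
# S2β · (REG) ∕ (R-3) FILE 2 — «hOSC AT THE THM-2 REPRESENTATIVE, ON THE CORNER BOX»: the rows' covariant oscillation letter `hOSC` (C₇b ✓p838589 `rows_K5_cov_osc`)
# INHABITED at a level-`j` datum whose components have word-oscillation `≤ |w|·c` in the background's transport — `O = 2·(d·3L)·c` — and, at a station's level `0`,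
# at the Thm-2 representative `U′^{u⁻¹} = e^{iηA}` of FILE 1 (✓-pending `…CovariantOscillationOfThm2`): `O (1) y′ = 2·(d·3L)·η²·B₁·(α₀+α₁)`

Cell `ym3-torus` (YM ladder rung R3 = continuum `SU(2)` Yang–Mills on the three-torus at fixed lattice data — a RUNG: NOT d = 4, NOT infinite volume, NOT a mass gap,
NOT Clay).  Width seat `ym3-torus-px13` (gen 29); crux `stmt-QuantumFields-20520`, LINE g18-1 S2β, the c₁ column's residue «SRC-VOL-R» (q1) ∕ desk RULING №126 plan R4.
`--kind proof --supports stmt-QuantumFields-20520 --as helper`, count-neutral, DEFINITION-FREE (0 `def`, 0 `instance`, 0 `notation`, 0 `sorry`, default heartbeats).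

WHAT IS PROVED (sorry-free).
§1 (`ℤᵈ`, generic normed `ℂ`-algebra) `norm_conjR_axialFn_sub_conjR_axialFn_le_of_words`: a WORD-OSCILLATION hypothesis `∀ x w, ‖conjR (hol V x w) (F (x + disp w)) − F x‖ ≤ |w|·c` gives the
   two-point comb form `‖conjR (axialFn V y x) (F x) − conjR (axialFn V y x′) (F x′)‖ ≤ (‖x−y‖₁ + ‖x′−y‖₁)·c` (the shape FILE 1 §4 exports, `c = η·B₁·(α₀+α₁)`).
§2 `l1_sub_le_of_box` (`‖x − lo‖₁ ≤ d·n` on a box of side `n`); THE BRIDGE «sandwich = `conjR` by the comb transport of the units reading» is px16 g24's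
   ✓`FluctuationComparisonRegPrIntLS2BetaCovariantOscillationTorusComb.coe_axialGauge_mul_mul_star` (requested 00:49Z with both end texts; imported, not restated).
§3 ★★`hOSC_of_wordOscillation` — `hOSC`'s LEFT SIDE BOUNDED: for `U₀ : GaugeField P j SU(N)` (`j + 2 ≤ m + K`), a matrix one-form `F : PBond P j → M_N(ℂ)` whose every direction-component has
   word-oscillation `≤ |w|·c` in `U₀♯`'s transport, and two same-direction bonds `b, b′` issuing from the four corner blocks of `(y′; μ, ν)`:
   `‖h(b₋)·F b·h(b₋)⋆ − h(b′₋)·F b′·h(b′₋)⋆‖ ≤ 2·(d·(3L))·c`, `h` = the four-block axial gauge WRITTEN OUT as in `hOSC`.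
§4 ★★`hOSC_at_representative_of_thm2SetupSUAt` — AT A STATION, LEVEL 0: from ONE member `Thm2SetupSUAt (F.P K) 2 (K−n) (eta F n K) …` (FILE 1 §4) the representative's `I•η•A` satisfies
   §3 with `c = η·(η·B₁·(α₀+α₁))`: so `hOSC` holds at `i = 0` for `U 0 = U₀`, `X 0 b = I•η•A b` (as matrices) with `O (1) y′ = 2·(d·3L)·(η²·B₁·(α₀+α₁))` — and the conditional ∕ `L ≥ 5`
   corollaries by FILE 1's two wrappers.

HONEST ∕ HAZARD «GAUGE-REP» (desk RULING №126).  As FILE 1: a statement about the THM-2 REPRESENTATIVE `U′^{u⁻¹}` (`u` (1.29)-restricted, NOT residual — node (RES-u), px12); levels `i ≥ 1`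
of the tower are NOT served here ((L2-TOWER)); the chart identification `X 0 b = logChart(U′^{u⁻¹} b) ↔ I•η•A b` is NOT typed here (FILE 3).  Nothing of Bałaban's analysis is proved;
`B8Thm2AtT3Members` UNPROVED at `L = 3`; GAP♯∘ (registry 3732b7df UNTOUCHED, 0∕5), the five registered stubs, S2β, crux 20520, 19936, 19200, `YM3TorusSU2` — NOT proved; rung R3 —
NOT d = 4, NOT infinite volume, NOT a mass gap, NOT Clay; the Yang–Mills mass gap is NOT proved.  Axioms standard.
-/

set_option autoImplicit false

noncomputable section

open scoped Matrix.Norms.L2Operator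

namespace Summit.QuantumFields.YangMills.Theorems.FluctuationComparisonRegPrIntLS2BetaCovariantOscillationCornerBox

open Literature.MathematicalPhysics.QuantumFieldTheory.Balaban1983to89
open B7Prop1Explicit (Letter e hol stepHol disp U1 hol_mem axialFn treeWord l1 length_treeWord disp_treeWord)
open B7Eq78Linearization (conjR conjR_apply conjR_sub conjR_smul)
open B8Ineq132 (covDerivFwd conjR_conjR one_conjR norm_conjR_le)
open B8Thm2SetupTorus (cfgPull gaugePull toUGauge Thm2SetupSUAt Restr129T InAxT Hyp135T)
open B10Eq27TorusAxialLog (pull transl toUField unitsField holT hol_pull holT_map holT_toUField val_suIncl suIncl transl_apply)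
open B10Eq68TorusRegularity (InSpace)
open B7Prop1Local (InBox)
open T4AxialGaugeSmallField (castSite castSite_apply axialGauge axialGauge_castSite boxBonds)
open T3ContinuumYM3Torus (T3Family)
open T3SectALandauChart (eta eta_pos)
open Summit.QuantumFields.YangMills.Theorems.FluctuationComparisonRegPrIntLS2BetaCovariantOscillationOfThm2
open Summit.QuantumFields.YangMills.Theorems.FluctuationComparisonRegPrIntLS2BetaCoarseCurlRemainderCovariant (mem_boxBonds_of_corner hi_le_lo_add_corner three_mul_lt_sitesPerDir)
open Summit.QuantumFields.YangMills.Theorems.FluctuationComparisonRegPrIntLS2BetaCovariantOscillationTorusComb (transl_zero_eq_castSite coe_axialGauge_mul_mul_star)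

/-! ## §1 The two-point comb form from a WORD-OSCILLATION hypothesis -/

section Words

variable {d : ℕ} {𝔸 : Type*} [NormedRing 𝔸]

/-- **TWO-POINT COMB FORM FROM WORD OSCILLATION**: if `F` moves by at most `|w|·c` under transport back along ANY word `w`, then its values at `x, x′` read in the axial gauge rooted at
`y` differ by at most `(‖x − y‖₁ + ‖x′ − y‖₁)·c`. [cite: Balaban1985Averaging, (9) p.18, (22) p.21] -/
theorem norm_conjR_axialFn_sub_conjR_axialFn_le_of_words {V : B7Prop1Explicit.Site d → Fin d → 𝔸ˣ} {F : B7Prop1Explicit.Site d → 𝔸} {c : ℝ}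
    (hosc : ∀ (x : B7Prop1Explicit.Site d) (w : List (Letter d)), ‖conjR (hol V x w) (F (x + disp w)) - F x‖ ≤ (w.length : ℝ) * c)
    (y x x' : B7Prop1Explicit.Site d) :
    ‖conjR (axialFn V y x) (F x) - conjR (axialFn V y x') (F x')‖ ≤ ((l1 (x - y) : ℝ) + l1 (x' - y)) * c := by
  have h1 := hosc y (treeWord (x - y))
  have h2 := hosc y (treeWord (x' - y))
  rw [disp_treeWord, add_sub_cancel, length_treeWord] at h1 h2
  calc ‖conjR (axialFn V y x) (F x) - conjR (axialFn V y x') (F x')‖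
      = ‖(conjR (hol V y (treeWord (x - y))) (F x) - F y) - (conjR (hol V y (treeWord (x' - y))) (F x') - F y)‖ := by
        rw [axialFn, axialFn]; congr 1; abel
    _ ≤ ‖conjR (hol V y (treeWord (x - y))) (F x) - F y‖ + ‖conjR (hol V y (treeWord (x' - y))) (F x') - F y‖ := norm_sub_le _ _
    _ ≤ (l1 (x - y) : ℝ) * c + (l1 (x' - y) : ℝ) * c := add_le_add h1 h2
    _ = ((l1 (x - y) : ℝ) + l1 (x' - y)) * c := by ring

end Words

/-! ## §2 The corner box's `ℓ¹` radius (the bridge itself — sandwich = `conjR` by the comb transport — is px16 g24's ✓`…CovariantOscillationTorusComb`) -/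

section Bridge

variable {P : Params}

/-- On the corner box `[lo, lo + 3L]ᵈ`: `‖x − lo‖₁ ≤ d·3L`. [folklore] -/
theorem l1_sub_le_of_box {lo x : Fin P.d → ℤ} {n : ℕ} (hx : lo ≤ x) (hn : ∀ κ, x κ ≤ lo κ + n) : (l1 (x - lo) : ℝ) ≤ (P.d : ℝ) * n := by
  have h : l1 (x - lo) ≤ P.d * n := by
    unfold l1
    calc ∑ κ, ((x - lo) κ).natAbs ≤ ∑ _κ : Fin P.d, n := Finset.sum_le_sum fun κ _ => by
            have h1 : lo κ ≤ x κ := hx κ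
            have h2 : x κ ≤ lo κ + n := hn κ
            rw [Pi.sub_apply]
            omega
      _ = P.d * n := by rw [Finset.sum_const, Finset.card_univ, Fintype.card_fin, smul_eq_mul]
  exact_mod_cast h

end Bridge

/-! ## §3 ★★ `hOSC`'s left side bounded from word oscillation, on the four corner blocks -/

section Corner

variable {P : Params} {j N : ℕ} [NeZero N]

/-- ★★ **THE ROWS' COVARIANT OSCILLATION LETTER FROM WORD OSCILLATION.**  Background `U₀ : GaugeField P j SU(N)` (`j + 2 ≤ m + K`), a matrix one-form `F` on the level-`j` bonds whose
every direction-component, read on the periodic pullback, moves by at most `|w|·c` under transport back along any word (`U₀♯ = pull (unitsField (toUField U₀)) 0`); then for two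
SAME-DIRECTION bonds `b, b′` issuing from the four corner blocks of `(y′; μ, ν)`, in the four-block axial gauge `h` of `U₀` (written out exactly as in C₇b's `hOSC`):
`‖h(b₋)·F b·h(b₋)⋆ − h(b′₋)·F b′·h(b′₋)⋆‖ ≤ 2·(d·3L)·c`. [cite: Balaban1985Averaging, (9) p.18, (22) p.21, pp.24-25; Balaban1987RG1, (0.3)-(0.4) pp.252-253] -/
theorem hOSC_of_wordOscillation (hj : j + 1 ≤ P.m + P.K) (hj2 : j + 2 ≤ P.m + P.K) (U₀ : GaugeField P j (Matrix.specialUnitaryGroup (Fin N) ℂ))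
    (F : PBond P j → Matrix (Fin N) (Fin N) ℂ) {c : ℝ} (hc : 0 ≤ c)
    (hosc : ∀ (κ : Fin P.d) (x : Fin P.d → ℤ) (w : List (Letter P.d)),
      ‖conjR (hol (pull (unitsField (toUField U₀)) 0) x w) (pull F 0 (x + disp w) κ) - pull F 0 x κ‖ ≤ (w.length : ℝ) * c)
    {μ ν : Fin P.d} (y' : Site P (j + 1)) (b b' : PBond P j)
    (hb : blockOf b.src = y' ∨ blockOf b.src = y'.shift μ ∨ blockOf b.src = y'.shift ν ∨ blockOf b.src = (y'.shift μ).shift ν)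
    (hb' : blockOf b'.src = y' ∨ blockOf b'.src = y'.shift μ ∨ blockOf b'.src = y'.shift ν ∨ blockOf b'.src = (y'.shift μ).shift ν)
    (hdir : b.dir = b'.dir) :
    ‖((axialGauge U₀ (fun κ : Fin P.d => (((emb y' κ).val : ℕ) : ℤ) - (((P.L - 1) / 2 : ℕ) : ℤ)) (fun κ : Fin P.d => (((emb y' κ).val : ℕ) : ℤ) + (((if κ = μ then (P.L : ℤ) else 0) + (if κ = ν then (P.L : ℤ) else 0)) + (((P.L - 1) / 2 : ℕ) : ℤ)) + 1) b.src : Matrix.specialUnitaryGroup (Fin N) ℂ) : Matrix (Fin N) (Fin N) ℂ) * F b * star ((axialGauge U₀ (fun κ : Fin P.d => (((emb y' κ).val : ℕ) : ℤ) - (((P.L - 1) / 2 : ℕ) : ℤ)) (fun κ : Fin P.d => (((emb y' κ).val : ℕ) : ℤ) + (((if κ = μ then (P.L : ℤ) else 0) + (if κ = ν then (P.L : ℤ) else 0)) + (((P.L - 1) / 2 : ℕ) : ℤ)) + 1) b.src : Matrix.specialUnitaryGroup (Fin N) ℂ) : Matrix (Fin N) (Fin N) ℂ) -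
      ((axialGauge U₀ (fun κ : Fin P.d => (((emb y' κ).val : ℕ) : ℤ) - (((P.L - 1) / 2 : ℕ) : ℤ)) (fun κ : Fin P.d => (((emb y' κ).val : ℕ) : ℤ) + (((if κ = μ then (P.L : ℤ) else 0) + (if κ = ν then (P.L : ℤ) else 0)) + (((P.L - 1) / 2 : ℕ) : ℤ)) + 1) b'.src : Matrix.specialUnitaryGroup (Fin N) ℂ) : Matrix (Fin N) (Fin N) ℂ) * F b' * star ((axialGauge U₀ (fun κ : Fin P.d => (((emb y' κ).val : ℕ) : ℤ) - (((P.L - 1) / 2 : ℕ) : ℤ)) (fun κ : Fin P.d => (((emb y' κ).val : ℕ) : ℤ) + (((if κ = μ then (P.L : ℤ) else 0) + (if κ = ν then (P.L : ℤ) else 0)) + (((P.L - 1) / 2 : ℕ) : ℤ)) + 1) b'.src : Matrix.specialUnitaryGroup (Fin N) ℂ) : Matrix (Fin N) (Fin N) ℂ)‖ ≤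
      2 * ((P.d : ℝ) * ((3 * P.L : ℕ) : ℝ)) * c := by
  -- the box and its two points
  set lo : Fin P.d → ℤ := fun κ => (((emb y' κ).val : ℕ) : ℤ) - (((P.L - 1) / 2 : ℕ) : ℤ) with hlo
  set hi : Fin P.d → ℤ := fun κ => (((emb y' κ).val : ℕ) : ℤ) + (((if κ = μ then (P.L : ℤ) else 0) + (if κ = ν then (P.L : ℤ) else 0)) + (((P.L - 1) / 2 : ℕ) : ℤ)) + 1 with hhi
  have hN : ∀ κ, hi κ - lo κ < P.sitesPerDir j := fun κ => by
    have h1 := hi_le_lo_add_corner (P := P) y' μ ν κ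
    have h2 := three_mul_lt_sitesPerDir (P := P) hj2
    have h3 : ((3 * P.L : ℕ) : ℤ) < (P.sitesPerDir j : ℤ) := by exact_mod_cast h2
    dsimp only at h1; rw [hhi, hlo]; dsimp only; linarith
  obtain ⟨x, hx, hxe, hsrc⟩ := mem_boxBonds_of_corner hj hj2 y' μ ν b hb
  obtain ⟨x', hx', hxe', hsrc'⟩ := mem_boxBonds_of_corner hj hj2 y' μ ν b' hb'
  have hxhi : x ≤ hi := (le_add_of_nonneg_right (B8Lemma1NonAbelian.e_nonneg b.dir)).trans hxe
  have hxhi' : x' ≤ hi := (le_add_of_nonneg_right (B8Lemma1NonAbelian.e_nonneg b'.dir)).trans hxe'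
  -- the two bond values are the pullback's values at `x`, `x′`
  have hFb : F b = pull F 0 x b.dir := by
    rw [B10Eq27TorusAxialLog.pull_apply, transl_zero_eq_castSite, ← hsrc]
  have hFb' : F b' = pull F 0 x' b.dir := by
    rw [B10Eq27TorusAxialLog.pull_apply, transl_zero_eq_castSite, ← hsrc', hdir]
  rw [hsrc, hsrc', coe_axialGauge_mul_mul_star U₀ hN hx hxhi, coe_axialGauge_mul_mul_star U₀ hN hx' hxhi', hFb, hFb']
  -- §1 with the word hypothesis for the component `b.dir`
  have h2pt := norm_conjR_axialFn_sub_conjR_axialFn_le_of_words (F := fun z => pull F 0 z b.dir) (fun z w => hosc b.dir z w) lo x x'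
  refine h2pt.trans ?_
  have hl : (l1 (x - lo) : ℝ) ≤ (P.d : ℝ) * ((3 * P.L : ℕ) : ℝ) :=
    l1_sub_le_of_box hx fun κ => hxhi κ |>.trans (hi_le_lo_add_corner (P := P) y' μ ν κ)
  have hl' : (l1 (x' - lo) : ℝ) ≤ (P.d : ℝ) * ((3 * P.L : ℕ) : ℝ) :=
    l1_sub_le_of_box hx' fun κ => hxhi' κ |>.trans (hi_le_lo_add_corner (P := P) y' μ ν κ)
  nlinarith

end Corner

/-! ## §4 ★★ At a station, level 0: `hOSC` at the Thm-2 representative -/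

section Station

/-- Scalars pass through the word oscillation: for `F♭ = I•(η•F)` the transported difference is `I•(η•(…))`, of norm `η·‖…‖`. [folklore] -/
theorem norm_conjR_smul_sub_smul {N : ℕ} {η : ℝ} (hη : 0 ≤ η)
    (X : (Matrix (Fin N) (Fin N) ℂ)ˣ) (Y Z : Matrix (Fin N) (Fin N) ℂ) :
    ‖conjR X (Complex.I • (η • Y)) - Complex.I • (η • Z)‖ = η * ‖conjR X Y - Z‖ := by
  rw [conjR_smul, B7Eq78Linearization.conjR_smul_real, ← smul_sub, ← smul_sub, norm_smul, Complex.norm_I, one_mul, norm_smul,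
    Real.norm_of_nonneg hη]

/-- ★★ **`hOSC` AT THE THM-2 REPRESENTATIVE, LEVEL 0, FROM ONE MEMBER OF THEOREM 2** (`Thm2SetupSUAt` at `P := F.P K`, `k = K − n`, `η = eta F n K`, slot `⊤`): for all `0 < α₀, α₁`,
`α₀ + α₁ ≤ c₁` and `SU(2)` data `U₀, U′` with (1.33)₁, (1.34), (1.35), FILE 1's representative `(u, A)` — `Restr129T`, `U′^{u⁻¹} = cfgExp η A♯`, (1.36)₁ — ALSO satisfies C₇b's covariant
oscillation letter `hOSC` at level `0` for the matrix datum `b ↦ I•(η•A b)` (`= log U₁(b)` as a matrix): for every coarse plaquette `(y′; μ, ν)` and two same-direction bonds `b, b′` from its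
four corner blocks, `‖h(b₋)·(IηA b)·h(b₋)⋆ − h(b′₋)·(IηA b′)·h(b′₋)⋆‖ ≤ 2·(d·3L)·(η·(η·B₁·(α₀+α₁)))` — i.e. `O (1) y′ = 6dL·η²·B₁·(α₀+α₁)`, ONE factor `η` below the size `η·B₁·(α₀+α₁)`
of the datum.  HAZARD «GAUGE-REP»: about `U′^{u⁻¹}`, `u` (1.29)-restricted, NOT residual ((RES-u)); levels `i ≥ 1`: (L2-TOWER).
[cite: Balaban1985RegularSpaces, Thm 2 p.83, (1.36) p.82, (1.29) p.81; Balaban1985Averaging, (9) p.18, (22) p.21, pp.24-25; Balaban1987RG1, (0.3)-(0.4) pp.252-253] -/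
theorem hOSC_at_representative_of_thm2SetupSUAt (F : T3Family) {n K : ℕ} (hnK : n < K) {β₀ B₁ B₂ c₁ : ℝ}
    {len : B7Prop1Explicit.Site (F.P K).d → ℝ}
    (hT : Thm2SetupSUAt (F.P K) 2 (K - n) (eta F n K) β₀ B₁ B₂ c₁ len (fun _ => True))
    ⦃α₀ α₁ : ℝ⦄ (hα₀ : 0 < α₀) (hα₁ : 0 < α₁) (hle : α₀ + α₁ ≤ c₁)
    (U₀ U' : GaugeField (F.P K) 0 (Matrix.specialUnitaryGroup (Fin 2) ℂ))
    (h33 : InSpace (K - n) (fun _ => (Set.univ : Set (Site (F.P K) 0))) α₀ (eta F n K) (toUField U₀))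
    (h34 : InSpace (K - n) (fun _ => (Set.univ : Set (Site (F.P K) 0))) α₀ (eta F n K) (toUField (fun b => U' b * U₀ b)))
    (hAx : InAxT (F.P K) (K - n) (toUField U₀) (toUField (fun b => U' b * U₀ b)))
    (h35 : Hyp135T (F.P K) (K - n) α₁ (toUField U₀) (toUField U')) :
    ∃ (u : GaugeTransf (F.P K) 0 (Matrix.specialUnitaryGroup (Fin 2) ℂ)) (A : GaugeField (F.P K) 0 (Matrix (Fin 2) (Fin 2) ℂ)),
      Restr129T (F.P K) (K - n) (toUField U₀) (toUGauge (F.P K) 2 u) ∧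
      (∀ b : PBond (F.P K) 0, IsSelfAdjoint (A b)) ∧
      B7Eq92Concrete.mgauge (cfgPull (F.P K) (toUField U₀)) (gaugePull (F.P K) (toUGauge (F.P K) 2 u))⁻¹ (cfgPull (F.P K) (toUField U')) =
        B8Eq184Proof.cfgExp (eta F n K) (pull A 0) ∧
      (∀ (κ : Fin (F.P K).d) (x : B7Prop1Explicit.Site (F.P K).d), ‖pull A 0 x κ‖ ≤ B₁ * (α₀ + α₁)) ∧
      ∀ (μ ν : Fin (F.P K).d) (y' : Site (F.P K) (0 + 1)) (b b' : PBond (F.P K) 0),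
        (blockOf b.src = y' ∨ blockOf b.src = y'.shift μ ∨ blockOf b.src = y'.shift ν ∨ blockOf b.src = (y'.shift μ).shift ν) →
        (blockOf b'.src = y' ∨ blockOf b'.src = y'.shift μ ∨ blockOf b'.src = y'.shift ν ∨ blockOf b'.src = (y'.shift μ).shift ν) →
        b.dir = b'.dir →
        ‖((axialGauge U₀ (fun κ : Fin (F.P K).d => (((emb y' κ).val : ℕ) : ℤ) - ((((F.P K).L - 1) / 2 : ℕ) : ℤ)) (fun κ : Fin (F.P K).d => (((emb y' κ).val : ℕ) : ℤ) + (((if κ = μ then ((F.P K).L : ℤ) else 0) + (if κ = ν then ((F.P K).L : ℤ) else 0)) + ((((F.P K).L - 1) / 2 : ℕ) : ℤ)) + 1) b.src : Matrix.specialUnitaryGroup (Fin 2) ℂ) : Matrix (Fin 2) (Fin 2) ℂ) * (Complex.I • ((eta F n K) • A b)) * star ((axialGauge U₀ (fun κ : Fin (F.P K).d => (((emb y' κ).val : ℕ) : ℤ) - ((((F.P K).L - 1) / 2 : ℕ) : ℤ)) (fun κ : Fin (F.P K).d => (((emb y' κ).val : ℕ) : ℤ) + (((if κ = μ then ((F.P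 K).L : ℤ) else 0) + (if κ = ν then ((F.P K).L : ℤ) else 0)) + ((((F.P K).L - 1) / 2 : ℕ) : ℤ)) + 1) b.src : Matrix.specialUnitaryGroup (Fin 2) ℂ) : Matrix (Fin 2) (Fin 2) ℂ) -
          ((axialGauge U₀ (fun κ : Fin (F.P K).d => (((emb y' κ).val : ℕ) : ℤ) - ((((F.P K).L - 1) / 2 : ℕ) : ℤ)) (fun κ : Fin (F.P K).d => (((emb y' κ).val : ℕ) : ℤ) + (((if κ = μ then ((F.P K).L : ℤ) else 0) + (if κ = ν then ((F.P K).L : ℤ) else 0)) + ((((F.P K).L - 1) / 2 : ℕ) : ℤ)) + 1) b'.src : Matrix.specialUnitaryGroup (Fin 2) ℂ) : Matrix (Fin 2) (Fin 2) ℂ) * (Complex.I • ((eta F n K) • A b')) * star ((axialGauge U₀ (fun κ : Fin (F.P K).d => (((emb y' κ).val : ℕ) : ℤ) - ((((F.P K).L - 1) / 2 : ℕ) : ℤ)) (fun κ : Fin (F.P K).d => (((emb y' κ).val : ℕ) : ℤ) + (((if κ = μ then ((F.P K).L : ℤ) else 0) + (if κ = ν then ((F.P K).L : ℤ) else 0))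 + ((((F.P K).L - 1) / 2 : ℕ) : ℤ)) + 1) b'.src : Matrix.specialUnitaryGroup (Fin 2) ℂ) : Matrix (Fin 2) (Fin 2) ℂ)‖ ≤
          2 * (((F.P K).d : ℝ) * ((3 * (F.P K).L : ℕ) : ℝ)) * (eta F n K * (eta F n K * (B₁ * (α₀ + α₁)))) := by
  obtain ⟨u, A, h29, hsa, hexp, hsup, hosc⟩ := oscLetter_of_thm2SetupSUAt F hT hα₀ hα₁ hle U₀ U' h33 h34 hAx h35
  refine ⟨u, A, h29, hsa, hexp, hsup, fun μ ν y' b b' hb hb' hdir => ?_⟩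
  have hm : 0 + 1 ≤ (F.P K).m + (F.P K).K := by have := F.hm; show 0 + 1 ≤ F.m + K; omega
  have hm2 : 0 + 2 ≤ (F.P K).m + (F.P K).K := by have := F.hm; show 0 + 2 ≤ F.m + K; omega
  have hc : 0 ≤ eta F n K * (eta F n K * (B₁ * (α₀ + α₁))) := by
    have hη := (eta_pos F n K).le
    have hB : 0 ≤ B₁ * (α₀ + α₁) := by
      exact (norm_nonneg _).trans (hsup μ 0)
    positivity
  refine hOSC_of_wordOscillation hm hm2 U₀ (fun b => Complex.I • ((eta F n K) • A b)) hc (fun κ x w => ?_) y' b b' hb hb' hdir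
  have h := hosc κ x w
  show ‖conjR (hol (cfgPull (F.P K) (toUField U₀)) x w) (Complex.I • (eta F n K • pull A 0 (x + disp w) κ)) - Complex.I • (eta F n K • pull A 0 x κ)‖ ≤ _
  rw [norm_conjR_smul_sub_smul (eta_pos F n K).le]
  calc eta F n K * ‖conjR (hol (cfgPull (F.P K) (toUField U₀)) x w) (pull A 0 (x + disp w) κ) - pull A 0 x κ‖
      ≤ eta F n K * ((w.length : ℝ) * (eta F n K * (B₁ * (α₀ + α₁)))) := mul_le_mul_of_nonneg_left h (eta_pos F n K).le
    _ = (w.length : ℝ) * (eta F n K * (eta F n K * (B₁ * (α₀ + α₁)))) := by ring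

end Station

end Summit.QuantumFields.YangMills.Theorems.FluctuationComparisonRegPrIntLS2BetaCovariantOscillationCornerBox

end
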